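import Summits.NavierStokesRegularity.OSWSelfSimilar.SheetREvansEven
import Summits.NavierStokesRegularity.OSWSelfSimilar.SheetRResolventConj
import HarnessLib

/-!
# SHEET-ℝ frame, Z3-SR-SPEC EVEN half S2⁺: the CONJUGATION SYMMETRY of the even perturbed resolvent — `R⁺_K(σ̄)` on real data is the
# conjugate of `R⁺_K(σ)`, hence `⟪h, R⁺_K(σ̄) f⟫ = conj ⟪h, R⁺_K(σ) f⟫` and `E⁺(σ̄) = conj E⁺(σ)` for real `h, f, θ`

HONEST FRAMING (cell ns-blowup GROUP B / zone Z3, case Z3-SR-SPEC EVEN half, step (S2⁺): the even left edge is certified for `Im σ ≥ 0` only and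
the lower half «by the exact conjugation symmetry `E⁺(σ̄) = conj E⁺(σ)` of the real operator» — the hypothesis `hsym` of
`SheetRSpectrumEvenPointAssembly.eq_half_of_pointDataE(A)` and of selfsim g14's `SheetRSpectrumEvenAssembly`; 1-D MODEL certificate frame (viscous
gCLM/OSW sheet on the line); not Euler/NS; «violates: none — MODEL»).  Nothing here is interval arithmetic and nothing asserts a profile or a zero
exists; the (S1⁺) Gårding datum `GardingDataKE` is the HYPOTHESIS, `K` arbitrary.  Even twin of `SheetRResolventConj` (odd class, selfsim g12),
same proof pattern: the weak pair system on zero-mass even tests with data `(g_R, −g_I)` at `σ̄` is solved by `(p_R, −p_I)` where `(p_R, p_I)` solves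
it with data `(g_R, g_I)` at `σ` (`pairOpKE_conj`, uniqueness `pairOpKE_unique`); hence for REAL `h = ofRealW a`, `f = ofRealW g`:
`⟪h, resolventKE σ̄ f⟫ = conj ⟪h, resolventKE σ f⟫` (`inner_resolventKE_conj`), and for real `θ` the Evans function on the even zero-mass class
satisfies `evansEven … (innerSL ℂ h) f θ (conj w) = conj (evansEven … w)` (`evansEven_conj_real`).  Pure functional analysis; no definition, no named fact.
WHAT THIS IS NOT: not NS; not the certificate; no number of record moves.
-/

noncomputable section

namespace Summit.NavierStokesRegularity.OSWSelfSimilar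
namespace SheetRResolventEvenConj

open _root_.MeasureTheory _root_.Set _root_.Filter _root_.Real SheetRWeakProfilePV SheetRWeakToStrong SheetREnergyClass SheetRWeightedMeasure
  SheetRLinearisedTests SheetREnergySpace SheetRTestSpace SheetRLinearisedFormBounds SheetREvenTests SheetREvenEnergySpace SheetREvenForms
  SheetREvenPairOperator SheetREvenPairUniqueness SheetRComplexPivot SheetREvenResolvent SheetREvenClass SheetRResolventEvenClass SheetREvansEven
  SheetRResolventConj
open scoped Topology ENNReal ComplexConjugate InnerProductSpace

variable {L D₀ D₁ V₀ c m : ℝ} {d V : ℝ → ℝ} {hL : 0 < L} {K : EspE L hL →L[ℝ] W L}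

/-- **Conjugation of the even pair solution operator**: `pairOpKE σ̄ (g_R, −g_I) = (p_R, −p_I)` where `(p_R, p_I) = pairOpKE σ (g_R, g_I)` —
the realified form of «the operator has real coefficients». [folklore] -/
theorem pairOpKE_conj (h : GardingDataKE L hL d V K D₀ D₁ V₀ c m) (σ : ℂ) (hσ : -m < σ.re) (G : WithLp 2 (W L × W L)) :
    pairOpKE hL K h (conj σ) (re_conj_gt hσ) (WithLp.toLp 2 (G.fst, -G.snd)) =
      WithLp.toLp 2 ((pairOpKE hL K h σ hσ G).fst, -(pairOpKE hL K h σ hσ G).snd) := by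
  set Q := pairOpKE hL K h σ hσ G with hQdef
  have hQ := (pairOpKE_spec hL K h σ hσ).1 G
  symm
  refine pairOpKE_unique hL K h (conj σ) (re_conj_gt hσ) _ fun v v₁ hv h0 => ?_
  obtain ⟨e1, e2⟩ := hQ v v₁ hv h0
  have hR1 : (WithLp.toLp 2 (Q.fst, -Q.snd) : WithLp 2 (EspE L hL × EspE L hL)).fst = Q.fst := rfl
  have hR2 : (WithLp.toLp 2 (Q.fst, -Q.snd) : WithLp 2 (EspE L hL × EspE L hL)).snd = -Q.snd := rfl
  have hD1 : (WithLp.toLp 2 (G.fst, -G.snd) : WithLp 2 (W L × W L)).fst = G.fst := rfl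
  have hD2 : (WithLp.toLp 2 (G.fst, -G.snd) : WithLp 2 (W L × W L)).snd = -G.snd := rfl
  rw [hR1, hR2, hD1, hD2, Complex.conj_re, Complex.conj_im]
  obtain ⟨hneg_ae, hneg_prof⟩ := derE_neg hL Q.snd
  have hlin : linForm L d (fun ξ => V ξ + σ.re) (profile (-Q.snd)) (derE (-Q.snd)) v v₁ =
      -1 * linForm L d (fun ξ => V ξ + σ.re) (profile Q.snd) (derE Q.snd) v v₁ := by
    rw [linForm_congr_ae L d _ (Eventually.of_forall fun y => congrFun hneg_prof y) hneg_ae]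
    exact linForm_smul_left L d _ (-1)
  have hcpl : ∫ y, (L ^ 2 + y ^ 2) * (profile (-Q.snd) y * v y) = -1 * ∫ y, (L ^ 2 + y ^ 2) * (profile Q.snd y * v y) := by
    rw [← integral_const_mul]
    refine integral_congr_ae (Eventually.of_forall fun y => ?_)
    show (L ^ 2 + y ^ 2) * (profile (-Q.snd) y * v y) = -1 * ((L ^ 2 + y ^ 2) * (profile Q.snd y * v y))
    rw [congrFun hneg_prof y]; ring
  have hdat : ∫ y, (L ^ 2 + y ^ 2) * ((((-G.snd : W L)) : ℝ → ℝ) y * v y) = -1 * ∫ y, (L ^ 2 + y ^ 2) * ((G.snd : ℝ → ℝ) y * v y) := by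
    rw [← integral_const_mul]
    refine integral_congr_ae ((ae_volume_of_ae_μw hL (Lp.coeFn_neg (G.snd : W L))).mono fun y hy => ?_)
    show (L ^ 2 + y ^ 2) * (((-G.snd : W L) : ℝ → ℝ) y * v y) = -1 * ((L ^ 2 + y ^ 2) * ((G.snd : ℝ → ℝ) y * v y))
    rw [hy, Pi.neg_apply]; ring
  have hK : ∫ y, (L ^ 2 + y ^ 2) * (((K (-Q.snd) : W L) : ℝ → ℝ) y * v y) = -1 * ∫ y, (L ^ 2 + y ^ 2) * (((K Q.snd : W L) : ℝ → ℝ) y * v y) := by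
    rw [← integral_const_mul, map_neg K]
    refine integral_congr_ae ((ae_volume_of_ae_μw hL (Lp.coeFn_neg (K Q.snd : W L))).mono fun y hy => ?_)
    show (L ^ 2 + y ^ 2) * (((-(K Q.snd) : W L) : ℝ → ℝ) y * v y) = -1 * ((L ^ 2 + y ^ 2) * (((K Q.snd : W L) : ℝ → ℝ) y * v y))
    rw [hy, Pi.neg_apply]; ring
  refine ⟨?_, ?_⟩
  · rw [hcpl]; linarith
  · rw [hlin, hK, hdat]; linarith

/-- **The even resolvent of real data at `σ` and at `σ̄`**: `R⁺_K(σ)(g) = ιEE p_R + i·ιEE p_I` and `R⁺_K(σ̄)(g) = ιEE p_R − i·ιEE p_I` with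
`(p_R, p_I) = pairOpKE σ (g, 0)`. [folklore] -/
theorem resolventKE_conj_real (h : GardingDataKE L hL d V K D₀ D₁ V₀ c m) {σ : ℂ} (hσ : -m < σ.re) (g : W L) :
    resolventKE hL K h σ (ofRealW L g) =
        ofRealW L (ιEE hL (pairOpKE hL K h σ hσ (WithLp.toLp 2 (g, 0))).fst)
          + (Complex.I : ℂ) • ofRealW L (ιEE hL (pairOpKE hL K h σ hσ (WithLp.toLp 2 (g, 0))).snd) ∧
      resolventKE hL K h (conj σ) (ofRealW L g) =
        ofRealW L (ιEE hL (pairOpKE hL K h σ hσ (WithLp.toLp 2 (g, 0))).fst)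
          - (Complex.I : ℂ) • ofRealW L (ιEE hL (pairOpKE hL K h σ hσ (WithLp.toLp 2 (g, 0))).snd) := by
  set Q := pairOpKE hL K h σ hσ (WithLp.toLp 2 (g, 0)) with hQ
  refine ⟨?_, ?_⟩
  · obtain ⟨h1, -, -, -⟩ := resolventKE_weak hL K h hσ (ofRealW L g)
    rw [h1, toPair_ofRealW, ofPair_apply, (ιpairE_fst_snd hL Q).1, (ιpairE_fst_snd hL Q).2]
  · obtain ⟨h1, -, -, -⟩ := resolventKE_weak hL K h (re_conj_gt hσ) (ofRealW L g)
    have hdata : (WithLp.toLp 2 (g, 0) : WithLp 2 (W L × W L)) =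
        WithLp.toLp 2 ((WithLp.toLp 2 (g, 0) : WithLp 2 (W L × W L)).fst, -(WithLp.toLp 2 (g, 0) : WithLp 2 (W L × W L)).snd) := by
      show (WithLp.toLp 2 (g, 0) : WithLp 2 (W L × W L)) = WithLp.toLp 2 (g, -0)
      rw [neg_zero]
    rw [h1, toPair_ofRealW, hdata, pairOpKE_conj h σ hσ, ofPair_apply, ← hQ]
    have hf : (ιpairE hL (WithLp.toLp 2 (Q.fst, -Q.snd))).fst = ιEE hL Q.fst := (ιpairE_fst_snd hL _).1
    have hs : (ιpairE hL (WithLp.toLp 2 (Q.fst, -Q.snd))).snd = ιEE hL (-Q.snd) := (ιpairE_fst_snd hL _).2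
    rw [hf, hs, map_neg, map_neg, smul_neg, sub_eq_add_neg]

/-- **THE CONJUGATION SYMMETRY**: for real `h = ofRealW a`, `f = ofRealW g` and every `σ ∈ ℂ` (inside or outside the half-plane),
`⟪h, R⁺_K(σ̄) f⟫ = conj ⟪h, R⁺_K(σ) f⟫`. [folklore] -/
theorem inner_resolventKE_conj (h : GardingDataKE L hL d V K D₀ D₁ V₀ c m) (a g : W L) (σ : ℂ) :
    ⟪ofRealW L a, resolventKE hL K h (conj σ) (ofRealW L g)⟫_ℂ = conj ⟪ofRealW L a, resolventKE hL K h σ (ofRealW L g)⟫_ℂ := by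
  by_cases hσ : -m < σ.re
  · obtain ⟨h1, h2⟩ := resolventKE_conj_real h hσ g
    rw [h1, h2, inner_sub_right, inner_add_right, inner_smul_right, map_add, map_mul, Complex.conj_I,
      conj_inner_ofRealW, conj_inner_ofRealW]
    ring
  · have hσ' : ¬ -m < (conj σ).re := by rwa [Complex.conj_re]
    rw [resolventKE_of_not hL K h hσ, resolventKE_of_not hL K h hσ']
    simp

/-- **`E(σ̄) = conj E(σ)`** for any Evans-type function `E(w) = 1 − θ⟪h, R⁺_K(w) f⟫` with real `h, f` and real `θ`. [folklore] -/
theorem evans_resolventKE_conj (h : GardingDataKE L hL d V K D₀ D₁ V₀ c m) (a g : W L) (θ : ℝ) {E : ℂ → ℂ}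
    (hE : ∀ w, E w = 1 - (θ : ℂ) * ⟪ofRealW L a, resolventKE hL K h w (ofRealW L g)⟫_ℂ) (w : ℂ) :
    E (conj w) = conj (E w) := by
  rw [hE, hE, inner_resolventKE_conj, map_sub, map_one, map_mul, Complex.conj_ofReal]

/-- The same with the realness of `h, f` stated as `Im h = 0`, `Im f = 0`. [folklore] -/
theorem evans_resolventKE_conj' (h : GardingDataKE L hL d V K D₀ D₁ V₀ c m) {hv f : Wc L} (hh : imW L hv = 0) (hf : imW L f = 0)
    (θ : ℝ) {E : ℂ → ℂ} (hE : ∀ w, E w = 1 - (θ : ℂ) * ⟪hv, resolventKE hL K h w f⟫_ℂ) (w : ℂ) :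
    E (conj w) = conj (E w) := by
  have e1 := eq_ofRealW_of_imW_eq_zero hh
  have e2 := eq_ofRealW_of_imW_eq_zero hf
  refine evans_resolventKE_conj h (reW L hv) (reW L f) θ (fun w' => ?_) w
  rw [hE w', ← e1, ← e2]

/-- The Evans function on the even zero-mass class, with `ℓ = ⟪h⁺, ·⟫`, has the shape `1 − θ⟪h⁺, R⁺_K(w) f⟫` in `L²_w(ℂ)` (the inner product of
the class is the ambient one). [folklore] -/
theorem evansEven_innerSL_apply (h : GardingDataKE L hL d V K D₀ D₁ V₀ c m) (hv f : WcevenZ hL) (θ w : ℂ) :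
    evansEven hL K h (innerSL ℂ hv) f θ w = 1 - θ * ⟪(hv : Wc L), resolventKE hL K h w (f : Wc L)⟫_ℂ := by
  rw [evansEven_apply, innerSL_apply_apply, Submodule.coe_inner, coe_resolventEven]

/-- **`E⁺(σ̄) = conj E⁺(σ)` ON THE EVEN ZERO-MASS CLASS** — the hypothesis `hsym` of `SheetRSpectrumEvenAssembly.eigen_iff_eq_half(A)` DISCHARGED for
real data: `h⁺, f ∈ WcevenZ` with `Im h⁺ = Im f = 0` and real `θ`. [folklore] -/
theorem evansEven_conj_real (h : GardingDataKE L hL d V K D₀ D₁ V₀ c m) {hv f : WcevenZ hL} (hh : imW L (hv : Wc L) = 0)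
    (hf : imW L (f : Wc L) = 0) (θ : ℝ) (w : ℂ) :
    evansEven hL K h (innerSL ℂ hv) f (θ : ℂ) (conj w) = conj (evansEven hL K h (innerSL ℂ hv) f (θ : ℂ) w) :=
  evans_resolventKE_conj' h hh hf θ (fun w' => evansEven_innerSL_apply h hv f (θ : ℂ) w') w

/-- A real even zero-mass element of `L²_w(ℂ)`: `ofRealW u` with `u ∈ WevenZ` lies in `WcevenZ` and has `Im = 0`, `Re = u`. [folklore] -/
theorem ofRealW_mem_WcevenZ {u : W L} (hu : u ∈ WevenZ hL) :
    ofRealW L u ∈ WcevenZ hL ∧ imW L (ofRealW L u) = 0 ∧ reW L (ofRealW L u) = u := by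
  have e : ofRealW L u = ofPair L (WithLp.toLp 2 (u, 0)) := by
    rw [← toPair_ofRealW u, ofPair_toPair]
  have hp : toPair L (ofRealW L u) = WithLp.toLp 2 (u, 0) := toPair_ofRealW u
  refine ⟨?_, ?_, ?_⟩
  · rw [e]
    exact ofPair_mem_WcevenZ hL hu (Submodule.zero_mem _)
  · rw [← (toPair_fst_snd (ofRealW L u)).2, hp]; rfl
  · rw [← (toPair_fst_snd (ofRealW L u)).1, hp]; rfl

end SheetRResolventEvenConj
end Summit.NavierStokesRegularity.OSWSelfSimilar

end
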